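import Mathlib.Analysis.Complex.OpenMapping
import Literature.Probability.RandomPlanarGeometry.ArmComplementCover
import Literature.Probability.RandomPlanarGeometry.CaratheodoryPeano
import Literature.Probability.RandomPlanarGeometry.CaratheodoryHalfPlane
import HarnessLib

/-!
# Boundary behaviour of conformal maps onto the remaining domain of an arm

Topic `Probability/RandomPlanarGeometry`. **The continuity theorem for conformal maps of `ℍ` onto the
remaining domain `Ĉ(η; ∞) = armComplement η` of an arm `η` running from `∞` to `0`** (Pommerenke,
*Boundary Behaviour of Conformal Maps* (1992), Thm 2.1, for this unbounded domain whose boundary is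
part of the curve `{∞} ∪ η ∪ {0}`, hence locally connected): for a continuous `η : ℝ → ℂ` with
`η(+∞) = 0`, `η(-∞) = ∞`, `0 ∉ η(ℝ)`, every conformal equivalence `φ : ℍ → armComplement η` has, at
every point of the closed half-plane, a limit in the Riemann sphere — a boundary value in `ℂ` or the
limit `∞` (`armComplement_boundary_limits`). This is exactly the hypothesis `hCT` of
`IsTwoSidedWholePlaneSLENatLawMeas.map_dilatePath_of_unique_of_continuityTheorem`
(`TwoSidedWholePlaneSLEScalingReduction`; corollary `continuityTheorem_armComplement`), which it
therefore DISCHARGES: the corrected class of two-sided whole-plane SLE_κ natural laws is closed under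
the dilations `dilatePath (1/d) a` unconditionally, and Zhan's Cor. 4.7 (self-similarity) is reduced
to the well-definedness of the corrected law alone.

Proof. `armComplement η` is open with frontier in the closed arm `A = {0} ∪ η(ℝ)`
(`ArmComplementTopology`). Koebe's square root `r` of `φ` on `ℍ` (`exists_differentiableOn_sq_eq`)
is injective with `r(ℍ) = Q` open (open mapping theorem) and `Q ∩ (-Q) = ∅`; with the pole
`p = -r(i) ∉ closure Q` the Möbius map `M(v) = 1/(v - p)` sends `Q` onto a bounded domain `G`, and
`Ψ = M ∘ r ∘ cayley⁻¹ : 𝔻 → G` is a conformal equivalence. The frontier of `G` lies in the cover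
`Cov(η, p) = M{v | v² ∈ A} ∪ {0}` (`ArmComplementCover`: points of `∂Q` square into `∂(armComplement η) ⊆ A`
because `closure Q ∩ (-Q) = ∅`), which is uniformly locally connected
(`isCompact_and_isUniformlyLocallyConnected_cover`) and disjoint from `G`; so the cover form of
Carathéodory's continuity theorem (`ConformalEquiv.exists_tendsto_of_mem_closedBall_of_cover`,
Pommerenke Thm 2.1 via Wolff's lemma and Janiszewski's theorem) gives limits of `Ψ` at every point of
the closed disc, i.e. limits of `M ∘ r` at every point of the closed half-plane; a non-zero limit `y`
gives the boundary value `(p + 1/y)²` of `φ = r²`, the limit `y = 0` gives `φ → ∞`.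

## References

* Ch. Pommerenke, *Boundary Behaviour of Conformal Maps* (1992), §2.2, Thm 2.1. [PommerenkeBBCM1992]
* L. V. Ahlfors, *Complex Analysis* (1979), Ch. 6 §1.1 (Koebe's square-root trick). [AhlforsCA1979]
-/

noncomputable section

open Set Filter Topology Metric Bornology Complex
open UpperHalfPlane (upperHalfPlaneSet)

namespace Literature.Probability.RandomPlanarGeometry

set_option quotPrecheck false in
/-- The boundary cover of `ArmComplementCover` (same notation). -/
local notation "Cov(" η ", " p ")" =>
  ((fun v : ℂ ↦ (v - p)⁻¹) '' {v : ℂ | v ^ 2 ∈ insert (0 : ℂ) (η '' Ici (0 : ℝ))} ∪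
    (fun u : ℂ ↦ u / (1 - p * u)) ''
      {u : ℂ | u ^ 2 ∈ insert (0 : ℂ) ((fun s : ℝ ↦ (η (-s))⁻¹) '' Ici (0 : ℝ))})

/-- **Injective holomorphic maps of `ℍ` are open** (open mapping theorem, Mathlib
`AnalyticOnNhd.is_constant_or_isOpen`; an injective map of `ℍ` is not constant). [folklore] -/
theorem isOpen_image_upperHalfPlaneSet_of_injOn {f : ℂ → ℂ} (hf : DifferentiableOn ℂ f upperHalfPlaneSet)
    (hinj : InjOn f upperHalfPlaneSet) : IsOpen (f '' upperHalfPlaneSet) := by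
  have hI : I ∈ upperHalfPlaneSet := by change 0 < I.im; simp
  have h2I : 2 * I ∈ upperHalfPlaneSet := by change 0 < (2 * I).im; simp
  rcases (hf.analyticOnNhd UpperHalfPlane.isOpen_upperHalfPlaneSet).is_constant_or_isOpen
    (convex_halfSpace_im_gt 0).isPreconnected with ⟨w, hw⟩ | h
  · exfalso
    have : I = 2 * I := hinj hI h2I ((hw I hI).trans (hw _ h2I).symm)
    have him := congrArg Complex.im this
    norm_num at him
  · exact h _ Subset.rfl UpperHalfPlane.isOpen_upperHalfPlaneSet

/-- **Continuity theorem for conformal maps onto the remaining domain of an arm** (Pommerenke (1992),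
Thm 2.1, for `Ĉ(η; ∞)`): for a continuous `η : ℝ → ℂ` with `η(t) → 0` as `t → +∞`, `η(t) → ∞` as
`t → -∞` and `η(t) ≠ 0`, every conformal equivalence `φ : ℍ → armComplement η` has, at every point `x`
of the closed half-plane, either a boundary value (`φ → y` within `ℍ`) or the limit `∞`
(`φ → ∞` within `ℍ`). See the module docstring for the proof (Koebe's square root, a Möbius
inversion, and the cover form `ConformalEquiv.exists_tendsto_of_mem_closedBall_of_cover` of
Carathéodory's theorem). [cite: PommerenkeBBCM1992, Thm. 2.1] -/
theorem armComplement_boundary_limits {η : ℝ → ℂ} (hc : Continuous η)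
    (htop : Tendsto η atTop (𝓝 0)) (hbot : Tendsto η atBot (cocompact ℂ)) (hne : ∀ t, η t ≠ 0)
    (φ : ConformalEquiv upperHalfPlaneSet (armComplement η)) {x : ℂ}
    (hx : x ∈ closure upperHalfPlaneSet) :
    (∃ y, Tendsto φ (𝓝[upperHalfPlaneSet] x) (𝓝 y)) ∨
      Tendsto φ (𝓝[upperHalfPlaneSet] x) (cocompact ℂ) := by
  -- the closed arm `A` and the remaining domain
  set A : Set ℂ := insert 0 (range η) with hA_def
  have hAcl : IsClosed A := isClosed_insert_zero_range hc htop hbot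
  have hDopen : IsOpen (armComplement η) :=
    Loewner.isOpen_unboundedComponent_of_isOpen hAcl.isOpen_compl
  have hDsub : armComplement η ⊆ Aᶜ := Loewner.unboundedComponent_subset _
  have hfrD : frontier (armComplement η) ⊆ A := by
    have := Loewner.frontier_unboundedComponent_subset hAcl.isOpen_compl
    rwa [compl_compl] at this
  have hφD : ∀ w ∈ upperHalfPlaneSet, φ w ∈ armComplement η := fun w hw ↦ φ.mapsTo hw
  have hφ0 : ∀ w ∈ upperHalfPlaneSet, φ w ≠ 0 := fun w hw h ↦
    hDsub (hφD w hw) (by rw [h]; exact mem_insert 0 _)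
  -- Koebe's square root `r` of `φ`
  obtain ⟨r, hrd, hr2⟩ := exists_differentiableOn_sq_eq φ.differentiableOn_coe hφ0
  have hr0 : ∀ w ∈ upperHalfPlaneSet, r w ≠ 0 := fun w hw h ↦
    hφ0 w hw (by rw [← hr2 w hw, h]; ring)
  have hrinj : InjOn r upperHalfPlaneSet := fun w hw w' hw' h ↦
    φ.injOn hw hw' (by rw [← hr2 w hw, ← hr2 w' hw', h])
  have hrneg : ∀ w ∈ upperHalfPlaneSet, ∀ w' ∈ upperHalfPlaneSet, r w ≠ -r w' := by
    intro w hw w' hw' h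
    have hww : w = w' := φ.injOn hw hw' (by rw [← hr2 w hw, ← hr2 w' hw', h, neg_sq])
    subst hww
    exact hr0 w hw (by linear_combination h / 2)
  set Q : Set ℂ := r '' upperHalfPlaneSet with hQ_def
  have hIH : I ∈ upperHalfPlaneSet := by change 0 < I.im; simp
  have hQne : Q.Nonempty := ⟨r I, I, hIH, rfl⟩
  have hQopen : IsOpen Q := isOpen_image_upperHalfPlaneSet_of_injOn hrd hrinj
  have hsqQ : MapsTo (fun v : ℂ ↦ v ^ 2) Q (armComplement η) := by
    rintro _ ⟨w, hw, rfl⟩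
    change r w ^ 2 ∈ armComplement η
    rw [hr2 w hw]
    exact hφD w hw
  -- no point of `closure Q` has its negative in `Q`
  have hnegQ : ∀ v ∈ closure Q, -v ∉ Q := by
    intro v hv hnv
    obtain ⟨q, hqN, hqQ⟩ : ((fun z : ℂ ↦ -z) ⁻¹' Q ∩ Q).Nonempty :=
      mem_closure_iff_nhds.1 hv _ ((continuous_neg.isOpen_preimage _ hQopen).mem_nhds hnv)
    obtain ⟨w, hw, hwq⟩ := hqQ
    obtain ⟨w', hw', hw'q⟩ := hqN
    exact hrneg w' hw' w hw (by rw [hw'q, hwq])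
  -- the pole `p = -r(i)`
  set p : ℂ := -r I with hp_def
  have hpQ : p ∉ closure Q := fun h ↦ hnegQ p h (by rw [hp_def, neg_neg]; exact ⟨I, hIH, rfl⟩)
  have hδ : 0 < infDist p Q := (infDist_pos_iff_notMem_closure hQne).1 hpQ
  have hvp : ∀ v ∈ Q, v ≠ p := fun v hv h ↦ hpQ (h ▸ subset_closure hv)
  have hp2 : p ^ 2 ∉ A := by
    rw [hp_def, neg_sq, hr2 I hIH]
    exact fun h ↦ hDsub (hφD I hIH) h
  -- the Möbius map `M(v) = 1/(v - p)` and the bounded domain `G = M(Q)`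
  set G : Set ℂ := (fun v : ℂ ↦ (v - p)⁻¹) '' Q with hG_def
  have hMr_d : DifferentiableOn ℂ (fun w ↦ (r w - p)⁻¹) upperHalfPlaneSet :=
    (hrd.sub_const p).inv fun w hw ↦ sub_ne_zero.2 (hvp _ ⟨w, hw, rfl⟩)
  have hMr_inj : InjOn (fun w ↦ (r w - p)⁻¹) upperHalfPlaneSet := fun w hw w' hw' h ↦
    hrinj hw hw' (sub_left_inj.1 (inv_inj.1 h))
  have hGeq : G = (fun w ↦ (r w - p)⁻¹) '' upperHalfPlaneSet := by
    rw [hG_def, hQ_def, image_image]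
  have hGopen : IsOpen G := by
    rw [hGeq]
    exact isOpen_image_upperHalfPlaneSet_of_injOn hMr_d hMr_inj
  have hGconn : IsPreconnected G := by
    rw [hGeq]
    exact (convex_halfSpace_im_gt 0).isPreconnected.image _ hMr_d.continuousOn
  have hGbdd : IsBounded G := by
    refine isBounded_iff_forall_norm_le.2 ⟨(infDist p Q)⁻¹, ?_⟩
    rintro _ ⟨v, hv, rfl⟩
    rw [norm_inv]
    refine inv_anti₀ hδ ?_
    calc infDist p Q ≤ dist p v := infDist_le_dist_of_mem hv
      _ = ‖v - p‖ := by rw [dist_eq_norm, norm_sub_rev]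
  have h0G : (0 : ℂ) ∉ G := by
    rintro ⟨v, hv, h⟩
    rw [inv_eq_zero, sub_eq_zero] at h
    exact hvp v hv h
  -- the conformal equivalence `Ψ = M ∘ r ∘ cayley⁻¹ : 𝔻 → G`
  have hball_sub : ball (0 : ℂ) 1 ⊆ {w : ℂ | w ≠ 1} := fun w hw h ↦ by
    rw [h, mem_ball_zero_iff, norm_one] at hw
    exact lt_irrefl _ hw
  have hcayInv : MapsTo cayleyInvFun (ball (0 : ℂ) 1) upperHalfPlaneSet := fun z hz ↦
    cayley.symm_mapsTo hz
  have hmemG : ∀ w ∈ upperHalfPlaneSet, (r w - p)⁻¹ ∈ G := fun w hw ↦ ⟨r w, ⟨w, hw, rfl⟩, rfl⟩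
  -- decoding points of `G`
  have hG_decode : ∀ u ∈ G, ∃ w ∈ upperHalfPlaneSet, u = (r w - p)⁻¹ ∧ p + u⁻¹ = r w ∧
      (p + u⁻¹) ^ 2 = φ w := by
    rintro _ ⟨_, ⟨w, hw, rfl⟩, rfl⟩
    refine ⟨w, hw, rfl, ?_, ?_⟩
    · rw [inv_inv, add_sub_cancel]
    · rw [inv_inv, add_sub_cancel, hr2 w hw]
  let Ψ : ConformalEquiv (ball (0 : ℂ) 1) G :=
    { toFun := fun z ↦ (r (cayleyInvFun z) - p)⁻¹
      invFun := fun u ↦ cayleyFun (φ.symm ((p + u⁻¹) ^ 2))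
      source := ball 0 1
      target := G
      map_source' := fun z hz ↦ hmemG _ (hcayInv hz)
      map_target' := fun u hu ↦ by
        obtain ⟨w, hw, -, -, hsq⟩ := hG_decode u hu
        rw [hsq, φ.symm_apply_apply hw]
        exact cayley.mapsTo hw
      left_inv' := fun z hz ↦ by
        have hw : cayleyInvFun z ∈ upperHalfPlaneSet := hcayInv hz
        change cayleyFun (φ.symm ((p + ((r (cayleyInvFun z) - p)⁻¹)⁻¹) ^ 2)) = z
        rw [inv_inv, add_sub_cancel, hr2 _ hw, φ.symm_apply_apply hw,
          cayleyFun_cayleyInvFun (hball_sub hz)]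
      right_inv' := fun u hu ↦ by
        obtain ⟨w, hw, rfl, -, hsq⟩ := hG_decode u hu
        rw [hsq, φ.symm_apply_apply hw, cayleyInvFun_cayleyFun (add_I_ne_zero (le_of_lt hw))]
      source_eq := rfl
      target_eq := rfl
      differentiableOn := hMr_d.comp (differentiableOn_cayleyInvFun.mono hball_sub) hcayInv
      differentiableOn_symm := by
        change DifferentiableOn ℂ (fun u ↦ cayleyFun (φ.symm ((p + u⁻¹) ^ 2))) G
        have h1 : DifferentiableOn ℂ (fun u : ℂ ↦ (p + u⁻¹) ^ 2) G :=
          ((differentiableOn_const p).add (differentiableOn_id.inv fun u hu h ↦ h0G (h ▸ hu))).pow 2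
        have h1m : MapsTo (fun u : ℂ ↦ (p + u⁻¹) ^ 2) G (armComplement η) := fun u hu ↦ by
          obtain ⟨w, hw, -, -, hsq⟩ := hG_decode u hu
          change (p + u⁻¹) ^ 2 ∈ armComplement η
          rw [hsq]
          exact hφD w hw
        have h2 : DifferentiableOn ℂ (fun u ↦ φ.symm ((p + u⁻¹) ^ 2)) G :=
          φ.symm.differentiableOn_coe.comp h1 h1m
        refine differentiableOn_cayleyFun.comp h2 fun u hu ↦ ?_
        exact add_I_ne_zero (le_of_lt (φ.symm_mapsTo (h1m hu))) }
  -- the boundary cover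
  obtain ⟨-, hPU⟩ := isCompact_and_isUniformlyLocallyConnected_cover (p := p) hc htop hbot hne hp2
  have hPG : Disjoint Cov(η, p) G := by
    rw [Set.disjoint_left]
    rintro u huP huG
    obtain ⟨w', hw', rfl, -, -⟩ := hG_decode u huG
    have hsqD : r w' ^ 2 ∈ armComplement η := by rw [hr2 w' hw']; exact hφD w' hw'
    rcases huP with ⟨v, hvS, hvu⟩ | ⟨t₀, ht₀S, ht₀u⟩
    · have hveq : v = r w' := sub_left_inj.1 (inv_inj.1 hvu)
      refine hDsub hsqD ?_
      rw [← hveq]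
      rcases hvS with h | ⟨t, -, ht⟩
      · exact Or.inl h
      · exact Or.inr ⟨t, ht⟩
    · by_cases ht0 : t₀ = 0
      · rw [ht0] at ht₀u
        have : (r w' - p)⁻¹ = 0 := by simpa using ht₀u.symm
        rw [inv_eq_zero, sub_eq_zero] at this
        exact hvp (r w') ⟨w', hw', rfl⟩ this
      · have hteq : t₀⁻¹ = r w' := by
          have h1 : t₀⁻¹ - p = t₀⁻¹ * (1 - p * t₀) := by
            rw [mul_sub, mul_one, ← mul_assoc, mul_comm t₀⁻¹ p, mul_assoc, inv_mul_cancel₀ ht0,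
              mul_one]
          have h2 : t₀ / (1 - p * t₀) = (t₀⁻¹ - p)⁻¹ := by
            rw [h1, mul_inv, inv_inv, div_eq_mul_inv]
          have h3 : (t₀⁻¹ - p)⁻¹ = (r w' - p)⁻¹ := h2 ▸ ht₀u
          exact sub_left_inj.1 (inv_inj.1 h3)
        refine hDsub hsqD ?_
        rw [← hteq, inv_pow]
        rcases ht₀S with h | ⟨s, -, hs⟩
        · exact absurd (pow_eq_zero_iff two_ne_zero |>.1 h) ht0
        · refine Or.inr ⟨-s, ?_⟩
          change η (-s) = (t₀ ^ 2)⁻¹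
          rw [← hs, inv_inv]
  have hfrP : frontier G ⊆ Cov(η, p) := by
    intro u hu
    rw [hGopen.frontier_eq] at hu
    obtain ⟨hucl, huG⟩ := hu
    by_cases hu0 : u = 0
    · rw [hu0]; exact zero_mem_cover
    -- `v = p + 1/u ∈ closure Q ∖ Q`
    have hNc : ContinuousAt (fun u : ℂ ↦ p + u⁻¹) u := continuousAt_const.add (continuousAt_inv₀ hu0)
    have hv : p + u⁻¹ ∈ closure ((fun u : ℂ ↦ p + u⁻¹) '' G) :=
      hNc.continuousWithinAt.mem_closure_image hucl
    have hNG : (fun u : ℂ ↦ p + u⁻¹) '' G = Q := by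
      apply Subset.antisymm
      · rintro _ ⟨u', hu', rfl⟩
        obtain ⟨w, hw, -, hpu, -⟩ := hG_decode u' hu'
        change p + u'⁻¹ ∈ Q
        rw [hpu]
        exact ⟨w, hw, rfl⟩
      · intro v hv
        refine ⟨(v - p)⁻¹, ⟨v, hv, rfl⟩, ?_⟩
        change p + ((v - p)⁻¹)⁻¹ = v
        rw [inv_inv, add_sub_cancel]
    rw [hNG] at hv
    have huv : u = (p + u⁻¹ - p)⁻¹ := by rw [add_sub_cancel_left, inv_inv]
    have hvQ : p + u⁻¹ ∉ Q := fun h ↦ huG (huv ▸ ⟨_, h, rfl⟩)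
    rw [huv]
    refine mem_cover_of_sq_mem hne (hfrD ?_)
    rw [hDopen.frontier_eq]
    refine ⟨map_mem_closure (f := fun v : ℂ ↦ v ^ 2) (continuous_pow 2) hv hsqQ, fun hmem ↦ ?_⟩
    -- if `v² ∈ armComplement η` then `v = ± r w`, impossible
    set w := φ.symm ((p + u⁻¹) ^ 2) with hw_def
    have hw : w ∈ upperHalfPlaneSet := φ.symm_mapsTo hmem
    have hφw : φ w = (p + u⁻¹) ^ 2 := φ.apply_symm_apply hmem
    have hsq : (p + u⁻¹) ^ 2 = r w ^ 2 := by rw [hr2 w hw, hφw]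
    rcases sq_eq_sq_iff_eq_or_eq_neg.1 hsq with h | h
    · exact hvQ (h ▸ ⟨w, hw, rfl⟩)
    · exact hnegQ _ hv (by rw [h, neg_neg]; exact ⟨w, hw, rfl⟩)
  -- Carathéodory's continuity theorem, cover form, at the point `cayley x` of the closed disc
  have hx_im : 0 ≤ x.im := mem_closure_upperHalfPlaneSet_iff.1 hx
  have hζ : cayleyFun x ∈ closedBall (0 : ℂ) 1 := mem_closedBall_zero_iff.2 (norm_cayleyFun_le_one hx_im)
  obtain ⟨y, hy⟩ := Ψ.exists_tendsto_of_mem_closedBall_of_cover hGopen hGconn hGbdd hPU hfrP hPG hζ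
  -- transfer to `ℍ`: `M (r w) → y` as `w → x` within `ℍ`
  have hC : Tendsto cayleyFun (𝓝[upperHalfPlaneSet] x) (𝓝[ball 0 1] (cayleyFun x)) := by
    have hcx : ContinuousWithinAt cayleyFun upperHalfPlaneSet x :=
      ((continuousOn_cayleyFun x (add_I_ne_zero hx_im)).continuousAt
        ((isOpen_ne_fun (continuous_id.add continuous_const) continuous_const).mem_nhds
          (add_I_ne_zero hx_im))).continuousWithinAt
    exact hcx.tendsto_nhdsWithin cayley.mapsTo
  have hT : Tendsto (fun w ↦ (r w - p)⁻¹) (𝓝[upperHalfPlaneSet] x) (𝓝 y) := by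
    refine (hy.comp hC).congr' ?_
    filter_upwards [self_mem_nhdsWithin] with w hw
    change (r (cayleyInvFun (cayleyFun w)) - p)⁻¹ = (r w - p)⁻¹
    rw [cayleyInvFun_cayleyFun (add_I_ne_zero (le_of_lt hw))]
  have hφr : ∀ᶠ w in 𝓝[upperHalfPlaneSet] x, r w ^ 2 = φ w :=
    eventually_of_mem self_mem_nhdsWithin fun w hw ↦ hr2 w hw
  by_cases hy0 : y = 0
  · -- the limit `∞`
    right
    have h1 : Tendsto (fun w ↦ (r w - p)⁻¹) (𝓝[upperHalfPlaneSet] x) (𝓝[≠] 0) := by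
      refine tendsto_nhdsWithin_iff.2 ⟨hy0 ▸ hT, ?_⟩
      filter_upwards [self_mem_nhdsWithin] with w hw
      exact inv_ne_zero (sub_ne_zero.2 (hvp _ ⟨w, hw, rfl⟩))
    have h2 : Tendsto (fun w ↦ r w - p) (𝓝[upperHalfPlaneSet] x) (cobounded ℂ) := by
      simpa only [Function.comp_def, inv_inv] using Filter.tendsto_inv₀_nhdsNE_zero.comp h1
    have h3 : Tendsto (fun w ↦ ‖r w - p‖) (𝓝[upperHalfPlaneSet] x) atTop :=
      tendsto_norm_atTop_iff_cobounded.2 h2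
    have h4 : Tendsto (fun w ↦ ‖r w‖) (𝓝[upperHalfPlaneSet] x) atTop := by
      refine tendsto_atTop_mono (fun w ↦ ?_) (tendsto_atTop_add_const_right _ (-‖p‖) h3)
      linarith [norm_sub_le (r w) p]
    have h5 : Tendsto (fun w ↦ ‖r w ^ 2‖) (𝓝[upperHalfPlaneSet] x) atTop := by
      simp only [norm_pow]
      exact (tendsto_pow_atTop two_ne_zero).comp h4
    rw [← cobounded_eq_cocompact, ← tendsto_norm_atTop_iff_cobounded]
    exact h5.congr' (by filter_upwards [hφr] with w hw; rw [hw])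
  · -- a boundary value
    left
    refine ⟨(p + y⁻¹) ^ 2, ?_⟩
    have h1 : Tendsto (fun w ↦ r w - p) (𝓝[upperHalfPlaneSet] x) (𝓝 y⁻¹) := by
      simpa only [inv_inv] using hT.inv₀ hy0
    have h2 : Tendsto (fun w ↦ r w) (𝓝[upperHalfPlaneSet] x) (𝓝 (p + y⁻¹)) := by
      have := h1.const_add p
      simpa only [add_sub_cancel] using this
    exact ((h2.pow 2).congr' hφr)

/-- **The continuity theorem for the remaining domain of an arm, in the form consumed by
`IsTwoSidedWholePlaneSLENatLawMeas.map_dilatePath_of_unique_of_continuityTheorem`** (hypothesis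
`hCT` there; the normalisations `φ(0) = 0`, `φ(∞) = ∞` are not needed). [cite: PommerenkeBBCM1992, Thm. 2.1] -/
theorem continuityTheorem_armComplement :
    ∀ η : ℝ → ℂ, Continuous η → Tendsto η atTop (𝓝 0) → Tendsto η atBot (cocompact ℂ) →
      (∀ t, η t ≠ 0) → ∀ φ : ConformalEquiv upperHalfPlaneSet (armComplement η),
        φ.HasBoundaryValue 0 0 → Tendsto φ (cocompact ℂ ⊓ 𝓟 upperHalfPlaneSet) (cocompact ℂ) →
          ∀ x ∈ closure upperHalfPlaneSet, (∃ y, Tendsto φ (𝓝[upperHalfPlaneSet] x) (𝓝 y)) ∨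
            Tendsto φ (𝓝[upperHalfPlaneSet] x) (cocompact ℂ) :=
  fun _ hc htop hbot hne φ _ _ _ hx ↦ armComplement_boundary_limits hc htop hbot hne φ hx

end Literature.Probability.RandomPlanarGeometry
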